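import Summits.CriticalPhenomena.PercolationContinuityZ3.Theorems.Transplant.DkSKGeo
import Summits.CriticalPhenomena.PercolationContinuityZ3.Theorems.Transplant.VPathKit
import Summits.CriticalPhenomena.PercolationContinuityZ3.Theorems.Transplant.Slab111SKPlan
import HarnessLib

/-!
# Diamond films `D_k` certificate (generic thickness), IV: the cleared set `Wset`, film paths from validated index lists, the branch from reachability, and CERTIFIED
# TERMINALS PASS THE FILTER

builds on p205010 (kernel theorem, internal audit signed; external expert review pending) — NOT used in this file.  Lane `prim-bschramm`, seat `prim-bschramm-p2` (gen 43; class C1b;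
memo `HOME/bschramm/P2-LATTICES.md` §152); helper file (`--supports stmt-CriticalPhenomena-4575 --as helper`).
«D4SKPath» for the thickness-generic layout of «DkSKDefs» (centre class condition `CtrOK C z`; terminals of the EXIT form `TerminalsX`, «SqShadowVRouteDataX», for the square
shadow `DiamondFilm.sqShadow` of the even film of thickness `C.k`):
* §1 `Wset C z` (the vertices of the valid bits of `C.W`), `testBit_WR_iff_mem`;
* §2 `gpath_of_idx`, `exists_walk_of_chain`, **`exists_branch_of_reach`**;
* §3 neighbour lists and **`terminals_sound`**: a `TerminalsX 4 z tR tD sR sD (Wset C z)`-certified triple has indices `(e₁, e₂, w)` with `e₁, e₂ ∈ esList` and `w ∈ needMask e₁ e₂`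
  (the exit neighbour passes the exit filter).
[cite: DuminilCopinSidoraviciusTassion2016, §2.3 (proof of Fact 2: u', v', w', the path γ_w)]
-/

noncomputable section

namespace Summit.CriticalPhenomena.PercolationContinuityZ3.Theorems.Transplant

open Literature.Probability.Percolation Literature.Probability.LatticeModels SimpleGraph

namespace DiamondFilm.DK

open Slab111.SK (bitOf sdiff lowIdx maskBelow maskOfList endsOK orFold rd rdMask testBit_bitOf testBit_sdiff testBit_maskBelow of_testBit_maskBelow testBit_maskBelow_of
  testBit_maskOfList testBit_maskOfList_eq_false endsOK_sound testBit_orFold)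
open DiamondFilm.SK (dT dA dB relU relV rel_eq digit_eq)

variable {C : DCtx} {z : Site 2}

/-! ## §0 Mask read-back (continued from «DkSKGeo») -/

/-- `inRB` implies validity. [folklore] -/
theorem validB_of_inRB {D : DCtx} {i : ℕ} (h : D.inRB i = true) : D.validB i = true := by
  simp only [DCtx.inRB, DCtx.inBlkB, Bool.and_eq_true] at h; exact h.1.1.1.1.1.1

/-- Rerouting-mask bits. [folklore] -/
theorem testBit_WR_iff (D : DCtx) (i : ℕ) : D.WR.testBit i = true ↔ D.W.testBit i = true ∧ D.inRB i = true := by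
  rw [DCtx.WR, Nat.testBit_land, Bool.and_eq_true, testBit_maskBelow, Bool.and_eq_true, decide_eq_true_eq]
  constructor
  · rintro ⟨hW, -, hR⟩; exact ⟨hW, hR⟩
  · rintro ⟨hW, hR⟩
    exact ⟨hW, ((validB_iff D i).1 (validB_of_inRB hR)).1, hR⟩

/-- Window-mask bits. [folklore] -/
theorem testBit_win_iff (D : DCtx) (i : ℕ) : D.win.testBit i = true ↔ D.inWinB i = true := by
  rw [DCtx.win, testBit_maskBelow, Bool.and_eq_true, decide_eq_true_eq]
  constructor
  · rintro ⟨-, h⟩; exact h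
  · intro h
    have hv : D.validB i = true := by simp only [DCtx.inWinB, Bool.and_eq_true] at h; exact h.1.1
    exact ⟨((validB_iff D i).1 hv).1, h⟩

/-- Exit-window-mask bits. [folklore] -/
theorem testBit_winD_iff (D : DCtx) (i : ℕ) : D.winD.testBit i = true ↔ D.inWinDB i = true := by
  rw [DCtx.winD, testBit_maskBelow, Bool.and_eq_true, decide_eq_true_eq]
  constructor
  · rintro ⟨-, h⟩; exact h
  · intro h
    have hv : D.validB i = true := by simp only [DCtx.inWinDB, Bool.and_eq_true] at h; exact h.1.1
    exact ⟨((validB_iff D i).1 hv).1, h⟩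

/-- Centre-mask bits. [folklore] -/
theorem testBit_cen_iff (D : DCtx) (i : ℕ) : D.cen.testBit i = true ↔ D.cenB i = true := by
  rw [DCtx.cen, testBit_maskBelow, Bool.and_eq_true, decide_eq_true_eq]
  constructor
  · rintro ⟨-, h⟩; exact h
  · intro h
    have hv : D.validB i = true := by simp only [DCtx.cenB, Bool.and_eq_true] at h; exact h.1.1
    exact ⟨((validB_iff D i).1 hv).1, h⟩

/-- `inRB` implies the radius-`4` bound. [folklore] -/
theorem sqBall_four_of_inRB (hz : CtrOK C z) {i : ℕ} (h : C.inRB i = true) : uv (vtx C.k z i) ∈ sqBall z 4 := by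
  rw [sqBall_vtx_iff hz (validB_of_inRB h)]
  simp only [DCtx.inRB, DCtx.inBlkB, Bool.and_eq_true, decide_eq_true_eq] at h
  omega

/-! ## §1 The cleared set -/

/-- **The cleared vertex set of the case at the block centre `z`**: the vertices of the valid bits of `C.W`. [folklore] -/
def Wset (C : DCtx) (z : Site 2) : Set (diamondFilm C.k) := {x | ∃ i, C.validB i = true ∧ C.W.testBit i = true ∧ vtx C.k z i = x}

/-- Membership of an index vertex in the cleared set. [folklore] -/
theorem vtx_mem_Wset_iff (hz : CtrOK C z) {i : ℕ} (hv : C.validB i = true) : vtx C.k z i ∈ Wset C z ↔ C.W.testBit i = true := by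
  constructor
  · rintro ⟨j, hj, hW, he⟩
    rw [vtx_inj hz hj hv he] at hW; exact hW
  · intro h; exact ⟨i, hv, h, rfl⟩

/-- A member of the cleared set is an index vertex. [folklore] -/
theorem exists_idx_of_mem_Wset {x : diamondFilm C.k} (h : x ∈ Wset C z) : ∃ i, C.validB i = true ∧ C.W.testBit i = true ∧ vtx C.k z i = x := h

/-- **The rerouting mask reads `Wset ∩ \overline{sqBlkR 4 z t_R s_R}`.** [folklore] -/
theorem testBit_WR_iff_mem (hk : Even C.k) (hz : CtrOK C z) {i : ℕ} (hv : C.validB i = true) {tR sR : ℕ} (htR : C.tR = min tR 4) (hsR : min C.sR 4 = min sR 4) :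
    C.WR.testBit i = true ↔ vtx C.k z i ∈ Wset C z ∩ (sqShadow hk).lift (sqBlkR 4 z tR sR) := by
  rw [testBit_WR_iff, Set.mem_inter_iff, vtx_mem_Wset_iff hz hv, SqShadow.mem_lift, sqShadow_sh, inRB_iff_mem_blkR hz hv htR hsR]

/-! ## §2 Paths from validated index lists; the branch from reachability -/

/-- **A validated index list is a self-avoiding path of `D_k`.** [folklore] -/
theorem gpath_of_idx (hz : CtrOK C z) {l : List ℕ} (hne : l ≠ []) (hv : ∀ x ∈ l, C.validB x = true) (hch : l.IsChain (AdjRel C))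
    (hnd : l.Nodup) : GPath (diamondGraph.induce (diamondFilm C.k)) (l.map (vtx C.k z)) (vtx C.k z (l.head hne)) (vtx C.k z (l.getLast hne)) where
  ne_nil := by simpa using hne
  chain := by
    rw [List.isChain_map]
    exact hch.imp_of_mem_imp fun a b ha hb hab => adj_vtx hz (hv a ha) (hv b hb) hab
  nodup := hnd.map_on fun a ha b hb hab => vtx_inj hz (hv a ha) (hv b hb) hab
  head := by rw [List.head?_map, List.head?_eq_some_head hne]; rfl
  last := by rw [List.getLast?_map, List.getLast?_eq_some_getLast hne]; rfl

/-- With known end points. [folklore] -/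
theorem gpath_of_idx' (hz : CtrOK C z) {l : List ℕ} {s t : ℕ} (hv : ∀ x ∈ l, C.validB x = true) (hch : l.IsChain (AdjRel C)) (hnd : l.Nodup)
    (hs : l.head? = some s) (ht : l.getLast? = some t) : GPath (diamondGraph.induce (diamondFilm C.k)) (l.map (vtx C.k z)) (vtx C.k z s) (vtx C.k z t) := by
  have hne : l ≠ [] := by rintro rfl; simp at hs
  have h1 : l.head hne = s := by rw [List.head?_eq_some_head hne, Option.some.injEq] at hs; exact hs
  have h2 : l.getLast hne = t := by rw [List.getLast?_eq_some_getLast hne, Option.some.injEq] at ht; exact ht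
  rw [← h1, ← h2]; exact gpath_of_idx hz hne hv hch hnd

/-- Membership read-back for mapped index lists. [folklore] -/
theorem mem_map_vtx_iff (hz : CtrOK C z) {l : List ℕ} (hv : ∀ x ∈ l, C.validB x = true) {j : ℕ} (hj : C.validB j = true) :
    vtx C.k z j ∈ l.map (vtx C.k z) ↔ j ∈ l := by
  rw [List.mem_map]
  constructor
  · rintro ⟨i, hi, he⟩; rw [← vtx_inj hz (hv i hi) hj he]; exact hi
  · intro h; exact ⟨j, h, rfl⟩

/-- A walk of `D_k` along an index walk. [folklore] -/
theorem exists_walk_of_chain (hz : CtrOK C z) (R : ℕ) (hR : ∀ i, R.testBit i = true → C.validB i = true) :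
    ∀ (l : List ℕ) (s : ℕ), (s :: l).IsChain (AdjRel C) → (∀ x ∈ s :: l, R.testBit x = true) →
      ∃ p : (diamondGraph.induce (diamondFilm C.k)).Walk (vtx C.k z s) (vtx C.k z (walkEnd s l)), ∀ v ∈ p.support, ∃ j ∈ s :: l, vtx C.k z j = v
  | [], s, _, _ => by
    refine ⟨Walk.nil, fun v hv => ⟨s, by simp, ?_⟩⟩
    exact (Walk.mem_support_nil_iff.mp hv).symm
  | j :: l, s, hch, hmem => by
    obtain ⟨hsj, hch'⟩ := List.isChain_cons_cons.1 hch
    obtain ⟨p, hp⟩ := exists_walk_of_chain hz R hR l j hch' fun x hx => hmem x (List.mem_cons_of_mem _ hx)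
    have hadj : (diamondGraph.induce (diamondFilm C.k)).Adj (vtx C.k z s) (vtx C.k z j) :=
      adj_vtx hz (hR _ (hmem s (by simp))) (hR _ (hmem j (by simp))) hsj
    have he : walkEnd s (j :: l) = walkEnd j l := rfl
    rw [he]
    refine ⟨Walk.cons hadj p, fun v hv => ?_⟩
    rw [Walk.support_cons, List.mem_cons] at hv
    rcases hv with rfl | hv
    · exact ⟨s, by simp, rfl⟩
    · obtain ⟨i, hi, rfl⟩ := hp v hv
      exact ⟨i, List.mem_cons_of_mem _ hi, rfl⟩

/-- **THE BRANCH FROM REACHABILITY**: a bit `w` of `C.reach R (bitOf b)` (all bits of `R` valid) is joined to `vtx b` by a self-avoiding path of `D_k` whose vertices are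
vertices of bits of `R`. [cite: DuminilCopinSidoraviciusTassion2016, §2.3 (proof of Fact 2: the path γ_w)] -/
theorem exists_branch_of_reach (hz : CtrOK C z) {R b w : ℕ} (hR : ∀ i, R.testBit i = true → C.validB i = true)
    (h : (C.reach R (bitOf b)).testBit w = true) :
    ∃ Br : List (diamondFilm C.k), GPath (diamondGraph.induce (diamondFilm C.k)) Br (vtx C.k z b) (vtx C.k z w) ∧
      ∀ x ∈ Br, ∃ j, C.validB j = true ∧ R.testBit j = true ∧ vtx C.k z j = x := by
  obtain ⟨s, l, hs, hRs, hw, he⟩ := reach_sound C h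
  rw [testBit_bitOf] at hs
  simp only [decide_eq_true_eq] at hs
  subst hs
  obtain ⟨p, hp⟩ := exists_walk_of_chain hz R hR l b hw.1 hw.2
  subst he
  have hsub := Walk.support_toPath_subset_support p
  generalize p.toPath = q at hsub
  obtain ⟨q, hqpath⟩ := q
  refine ⟨q.support, ⟨q.support_ne_nil, q.isChain_adj_support, hqpath.support_nodup, ?_, ?_⟩, ?_⟩
  · rw [List.head?_eq_some_head q.support_ne_nil, Walk.head_support]
  · rw [List.getLast?_eq_some_getLast q.support_ne_nil, Walk.getLast_support]
  · intro x hx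
    obtain ⟨j, hj, rfl⟩ := hp x (hsub hx)
    exact ⟨j, hR _ (hw.2 j hj), hw.2 j hj, rfl⟩

/-! ## §3 Neighbour lists; certified terminals pass the filter -/

/-- An adjacent index is listed by `nbrList`. [folklore] -/
theorem mem_nbrList {D : DCtx} {e j : ℕ} (h : D.adjB e j = true) : j ∈ D.nbrList e := by
  unfold DCtx.nbrList
  rw [List.mem_filter]
  refine ⟨?_, h⟩
  have h' := (adjB_iff D).1 h
  obtain ⟨hve, hvj, hh, h'⟩ := h'
  have hde := digits D e hve
  have hdj := digits D j hvj
  obtain ⟨ae, be, te⟩ := digit_eq e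
  obtain ⟨aj, bj, tj⟩ := digit_eq j
  have ge := hgt_eq D e
  have gj := hgt_eq D j
  have re := res_cases D e
  have rj := res_cases D j
  simp only [List.mem_cons, List.not_mem_nil, or_false]
  rcases h' with ⟨-, hb, ha⟩ | ⟨-, ha, hb⟩
  · -- horizontal: same tag
    have ht : dT e = dT j := by
      rcases re with ⟨p1, q1, r1⟩ | ⟨p1, q1, r1⟩ | ⟨p1, q1, r1⟩ | ⟨p1, q1, r1⟩ <;>
        rcases rj with ⟨p2, q2, r2⟩ | ⟨p2, q2, r2⟩ | ⟨p2, q2, r2⟩ | ⟨p2, q2, r2⟩ <;> omega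
    rcases ha with ha | ha
    · exact Or.inr (Or.inl (by omega))
    · exact Or.inl (by omega)
  · -- vertical: same tag between residues 1, 2; tag change between residues 3, 0
    have key : (dT e = dT j ∧ 1 ≤ D.res e ∧ D.res e ≤ 2) ∨ (dT j = dT e + 1 ∧ D.res e = 3) ∨ (dT e = dT j + 1 ∧ D.res e = 0) := by
      rcases re with ⟨p1, q1, r1⟩ | ⟨p1, q1, r1⟩ | ⟨p1, q1, r1⟩ | ⟨p1, q1, r1⟩ <;>
        rcases rj with ⟨p2, q2, r2⟩ | ⟨p2, q2, r2⟩ | ⟨p2, q2, r2⟩ | ⟨p2, q2, r2⟩ <;> omega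
    rcases key with ⟨ht, -, -⟩ | ⟨ht, -⟩ | ⟨ht, -⟩
    · rcases hb with hb | hb
      · exact Or.inr (Or.inr (Or.inr (Or.inl (by omega))))
      · exact Or.inr (Or.inr (Or.inl (by omega)))
    · rcases hb with hb | hb
      · exact Or.inr (Or.inr (Or.inr (Or.inr (Or.inr (Or.inl (by omega))))))
      · exact Or.inr (Or.inr (Or.inr (Or.inr (Or.inl (by omega)))))
    · rcases hb with hb | hb
      · exact Or.inr (Or.inr (Or.inr (Or.inr (Or.inr (Or.inr (Or.inr (by omega)))))))
      · exact Or.inr (Or.inr (Or.inr (Or.inr (Or.inr (Or.inr (Or.inl (by omega)))))))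

/-- Members of `nbrList` are adjacent (hence valid). [folklore] -/
theorem of_mem_nbrList {D : DCtx} {e j : ℕ} (h : j ∈ D.nbrList e) : D.validB j = true ∧ D.adjB e j = true := by
  unfold DCtx.nbrList at h
  rw [List.mem_filter] at h
  exact ⟨((adjB_iff D).1 h.2).2.1, h.2⟩

/-- An outside window neighbour is listed by `outs`. [folklore] -/
theorem mem_outs {D : DCtx} {e j : ℕ} (h : D.adjB e j = true) (hwin : D.inWinB j = true) (hW : D.W.testBit j = false) : j ∈ D.outs e := by
  unfold DCtx.outs
  rw [List.mem_filter]
  exact ⟨mem_nbrList h, by rw [(testBit_win_iff D j).2 hwin, hW]; rfl⟩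

/-- A window neighbour is listed by `ins`. [folklore] -/
theorem mem_ins {D : DCtx} {e j : ℕ} (h : D.adjB e j = true) (hwin : D.inWinB j = true) : j ∈ D.ins e := by
  unfold DCtx.ins
  rw [List.mem_filter]
  exact ⟨mem_nbrList h, (testBit_win_iff D j).2 hwin⟩

/-- Members of `outs` are valid. [folklore] -/
theorem validB_of_mem_outs {C : DCtx} {e j : ℕ} (h : j ∈ C.outs e) : C.validB j = true := by
  unfold DCtx.outs at h; rw [List.mem_filter] at h; exact (of_mem_nbrList h.1).1

/-- Members of `ins` are valid. [folklore] -/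
theorem validB_of_mem_ins {C : DCtx} {e j : ℕ} (h : j ∈ C.ins e) : C.validB j = true := by
  unfold DCtx.ins at h; rw [List.mem_filter] at h; exact (of_mem_nbrList h.1).1

/-- Membership in the terminal list. [folklore] -/
theorem mem_esList {C : DCtx} {e : ℕ} (hv : C.validB e = true) (hWR : C.WR.testBit e = true) (hcen : C.cen.testBit e = false) {j : ℕ} (hj : j ∈ C.outs e) :
    e ∈ C.esList := by
  unfold DCtx.esList
  rw [List.mem_filter, List.mem_range]
  refine ⟨((validB_iff C e).1 hv).1, ?_⟩
  rw [hWR, hcen]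
  have : (C.outs e).isEmpty = false := by
    cases h : C.outs e with
    | nil => rw [h] at hj; simp at hj
    | cons _ _ => rfl
  rw [this]; rfl

/-- Boolean inequality from distinct index vertices of `D_k`. [folklore] -/
theorem bne_of_vtx_ne {k : ℕ} {i j : ℕ} (h : vtx k z i ≠ vtx k z j) : (i != j) = true := by
  rw [bne_iff_ne]; rintro rfl; exact h rfl

/-- **CERTIFIED TERMINALS (EXIT FORM) PASS THE BITBOARD FILTER.**  [cite: DuminilCopinSidoraviciusTassion2016, §2.3 (proof of Fact 2: u', v', w' and π outside B̄_R(z))] -/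
theorem terminals_sound (hk : Even C.k) (hz : CtrOK C z) {tR tD sR sD : ℕ} (htR : C.tR = min tR 4) (hsR : min C.sR 4 = min sR 4)
    (hwT : tD ≤ C.tD ∨ 5 ≤ C.tD) (hwS : sR ≤ C.sR ∨ 5 ≤ C.sR) (hwD : sD ≤ C.sD ∨ 5 ≤ C.sD) (hWD : ∀ i, C.W.testBit i = true → C.inDB i = true)
    {E₁ E₂ w' : diamondFilm C.k} (hT : (sqShadow hk).TerminalsX 4 z tR tD sR sD (Wset C z) E₁ E₂ w') :
    ∃ e1 e2 w, C.validB e1 = true ∧ C.validB e2 = true ∧ C.validB w = true ∧ vtx C.k z e1 = E₁ ∧ vtx C.k z e2 = E₂ ∧ vtx C.k z w = w' ∧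
      C.WR.testBit e1 = true ∧ C.WR.testBit e2 = true ∧ C.W.testBit w = true ∧
      e1 ∈ C.esList ∧ e2 ∈ C.esList ∧ e1 ≠ e2 ∧ (C.needMask e1 e2).testBit w = true := by
  obtain ⟨e1, hv1, hW1, rfl⟩ := exists_idx_of_mem_Wset hT.E₁W
  obtain ⟨e2, hv2, hW2, rfl⟩ := exists_idx_of_mem_Wset hT.E₂W
  obtain ⟨w, hvw, hWw, rfl⟩ := exists_idx_of_mem_Wset hT.w'W
  have hne : e1 ≠ e2 := fun h => hT.ne (by rw [h])
  have hE₁R := hT.E₁R; have hE₂R := hT.E₂R; have hE₁z := hT.E₁z; have hE₂z := hT.E₂z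
  have hw'z := hT.w'z; have hw'E₁ := hT.w'E₁; have hw'E₂ := hT.w'E₂
  rw [sqShadow_sh] at hE₁R hE₂R hE₁z hE₂z hw'z hw'E₁ hw'E₂
  have hR1 : C.inRB e1 = true := (inRB_iff_mem_blkR hz hv1 htR hsR).2 hE₁R
  have hR2 : C.inRB e2 = true := (inRB_iff_mem_blkR hz hv2 htR hsR).2 hE₂R
  have hWR1 : C.WR.testBit e1 = true := (testBit_WR_iff C e1).2 ⟨hW1, hR1⟩
  have hWR2 : C.WR.testBit e2 = true := (testBit_WR_iff C e2).2 ⟨hW2, hR2⟩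
  have h41 := sqBall_four_of_inRB hz hR1
  have h42 := sqBall_four_of_inRB hz hR2
  have cenFalse : ∀ {i : ℕ}, C.validB i = true → uv (vtx C.k z i) ≠ z → C.cen.testBit i = false := by
    intro i hv hne'
    rw [Bool.eq_false_iff]
    intro h
    exact hne' ((cenB_iff hz hv).1 ((testBit_cen_iff C i).1 h))
  have hc1 : C.cen.testBit e1 = false := cenFalse hv1 hE₁z
  have hc2 : C.cen.testBit e2 = false := cenFalse hv2 hE₂z
  have hcw : C.cen.testBit w = false := cenFalse hvw hw'z
  -- the four γ-neighbours
  obtain ⟨o₁, a₁, a₂, o₂, ho1, ha1, ha2, ho2, ho1W, ho2W, hwo1, hwa1, hwa2, hwo2, hn1, hn2, hn3, hn4, hn5, hn6, hn7, hn8, hc01, hca1, hca2, hco2⟩ :=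
    hT.nbrs
  rw [sqShadow_sh] at hwo1 hwa1 hwa2 hwo2 hn8 hc01 hca1 hca2 hco2
  obtain ⟨jo1, hvo1, rfl, hro1⟩ := exists_idx_of_adj hz hv1 h41 ho1.symm
  obtain ⟨ja1, hva1, rfl, hra1⟩ := exists_idx_of_adj hz hv1 h41 ha1
  obtain ⟨ja2, hva2, rfl, hra2⟩ := exists_idx_of_adj hz hv2 h42 ha2.symm
  obtain ⟨jo2, hvo2, rfl, hro2⟩ := exists_idx_of_adj hz hv2 h42 ho2
  have hWo1 : C.W.testBit jo1 = false := by rw [Bool.eq_false_iff]; intro h; exact ho1W ((vtx_mem_Wset_iff hz hvo1).2 h)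
  have hWo2 : C.W.testBit jo2 = false := by rw [Bool.eq_false_iff]; intro h; exact ho2W ((vtx_mem_Wset_iff hz hvo2).2 h)
  have mo1 : jo1 ∈ C.outs e1 := mem_outs hro1 (inWinB_of_inWin hz hvo1 hwT hwS hwo1) hWo1
  have ma1 : ja1 ∈ C.ins e1 := mem_ins hra1 (inWinB_of_inWin hz hva1 hwT hwS hwa1)
  have mo2 : jo2 ∈ C.outs e2 := mem_outs hro2 (inWinB_of_inWin hz hvo2 hwT hwS hwo2) hWo2
  have ma2 : ja2 ∈ C.ins e2 := mem_ins hra2 (inWinB_of_inWin hz hva2 hwT hwS hwa2)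
  refine ⟨e1, e2, w, hv1, hv2, hvw, rfl, rfl, rfl, hWR1, hWR2, hWw, mem_esList hv1 hWR1 hc1 mo1, mem_esList hv2 hWR2 hc2 mo2, hne, ?_⟩
  -- the need mask: the `Terminals` part
  have colFalse : ∀ {e i : ℕ}, C.validB e = true → C.validB i = true → uv (vtx C.k z i) ≠ uv (vtx C.k z e) → (C.colM e).testBit i = false := by
    intro e i hve hvi hne'
    rw [Bool.eq_false_iff]
    intro h
    exact hne' ((testBit_colM_iff_sh hz hve hvi).1 h)
  have hacc : (orFold (C.outs e1) fun o1 => orFold (C.ins e1) fun a1 => orFold (C.outs e2) fun o2 => orFold (C.ins e2) fun a2 =>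
      bif C.quadOK e1 e2 o1 a1 o2 a2 then sdiff C.W (C.cen ||| C.colM e1 ||| C.colM e2 ||| C.colM o1 ||| C.colM a1 ||| C.colM a2 ||| C.colM o2) else 0).testBit w = true := by
    rw [testBit_orFold]
    refine ⟨jo1, mo1, ?_⟩
    rw [testBit_orFold]
    refine ⟨ja1, ma1, ?_⟩
    rw [testBit_orFold]
    refine ⟨jo2, mo2, ?_⟩
    rw [testBit_orFold]
    refine ⟨ja2, ma2, ?_⟩
    have hq : C.quadOK e1 e2 jo1 ja1 jo2 ja2 = true := by
      unfold DCtx.quadOK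
      simp only [Bool.and_eq_true, Bool.or_eq_true]
      refine ⟨⟨⟨⟨⟨⟨⟨bne_of_vtx_ne hn1, bne_of_vtx_ne hn2⟩, bne_of_vtx_ne (Ne.symm hn5)⟩, bne_of_vtx_ne (Ne.symm hn7)⟩, bne_of_vtx_ne hn3⟩,
        bne_of_vtx_ne hn4⟩, bne_of_vtx_ne (Ne.symm hn6)⟩, ?_⟩
      by_cases h12 : ja1 = ja2
      · right
        exact (testBit_cen_iff C ja1).2 ((cenB_iff hz hva1).2 (hn8 (by rw [h12])))
      · left; exact bne_iff_ne.2 h12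
    rw [hq, cond_true]
    simp only [testBit_sdiff, Nat.testBit_lor, hWw, hcw, colFalse hv1 hvw hw'E₁, colFalse hv2 hvw hw'E₂,
      colFalse hvo1 hvw hc01, colFalse hva1 hvw hca1, colFalse hva2 hvw hca2, colFalse hvo2 hvw hco2, Bool.or_false, Bool.not_false, Bool.and_true]
  -- the exit filter
  unfold DCtx.needMask
  rw [Nat.testBit_land, Bool.and_eq_true]
  refine ⟨hacc, testBit_maskBelow_of ((validB_iff C w).1 hvw).1 ?_⟩
  rw [Bool.and_eq_true]
  refine ⟨hacc, ?_⟩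
  obtain ⟨x, hwx, hxW, hxwin, hxz, hx1, hx2⟩ := hT.w'x
  rw [sqShadow_sh] at hxwin hxz hx1 hx2
  have hw4 : uv (vtx C.k z w) ∈ sqBall z 4 := by
    have hD := hWD w hWw
    rw [sqBall_vtx_iff hz hvw]
    simp only [DCtx.inDB, DCtx.inBlkB, Bool.and_eq_true, decide_eq_true_eq] at hD
    omega
  obtain ⟨jx, hvx, rfl, hrx⟩ := exists_idx_of_adj hz hvw hw4 hwx
  unfold DCtx.exitOK
  rw [List.any_eq_true]
  refine ⟨jx, mem_nbrList hrx, ?_⟩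
  have hWx : C.W.testBit jx = false := by rw [Bool.eq_false_iff]; intro h; exact hxW ((vtx_mem_Wset_iff hz hvx).2 h)
  rw [Bool.and_eq_true, Bool.and_eq_true, hWx, (testBit_winD_iff C jx).2 (inWinDB_of_inWin hz hvx hwT hwD hxwin)]
  refine ⟨⟨rfl, rfl⟩, ?_⟩
  rw [beq_iff_eq]
  apply Nat.eq_of_testBit_eq
  intro i
  rw [Nat.zero_testBit, Nat.testBit_land, Bool.and_eq_false_iff]
  by_cases hi : (C.colM jx).testBit i = true
  · right
    obtain ⟨hvi, hmod⟩ := (testBit_colM_iff C jx i).1 hi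
    have hshi : uv (vtx C.k z i) = uv (vtx C.k z jx) := (sh_eq_iff_mod hz hvi hvx).2 hmod
    rw [Nat.testBit_lor, Nat.testBit_lor, Bool.or_eq_false_iff, Bool.or_eq_false_iff]
    refine ⟨⟨cenFalse hvi (by rw [hshi]; exact hxz), colFalse hv1 hvi (by rw [hshi]; exact hx1)⟩, colFalse hv2 hvi (by rw [hshi]; exact hx2)⟩
  · left; simpa using hi

end DiamondFilm.DK

end Summit.CriticalPhenomena.PercolationContinuityZ3.Theorems.Transplant

end
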